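import Summits.QuantumFields.YangMills.Theorems.BalabanUVNodesN15CovariantTwoGridLineProductDefect
import HarnessLib

/-!
# N15 = NE2, road (c) — PROGRAMME (PC) «[B9] Sect. C FOR THE LANDAU LETTER WITH PER-CUBE GAUGES», (PC-E-H) THE HÖLDER-NATIVE DIVERGENCE FIT, PART 1: THE LINE PRODUCTS AT TWO
# SPACINGS WITH A PAIRWISE THIRD LETTER — `‖Π_{t<N}T_{N+t} − Π_{t<N}T_t − N²·(T_N − T_{N−1})‖ ≤ 2N³αβ + N²Γ`, `Γ` a bound on the differences of ANY TWO forward differences along the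
# line (no per-step summation), and the adjoint-action combination at two spacings in the Frobenius norm (dag-n15-c g34, n15-c∕368)

Cell `pub-ymgap`, seat `pub-ymgap-dag-n15-c` (generation g34; R134 (a) seat, strategy s1 «first missing estimate»; HUMAN RULING D-0062; chair R424 venue).
`bears_on: R4∕N15 · K3⁸ SpineGivenEndpointR13SepCoPHV (stmt-QuantumFields-27366)`; filed `--kind proof --supports stmt-QuantumFields-27366 --as helper` — COUNT-NEUTRAL.
Theorems only (generic finite-dimensional matrix analysis), 0 `def`, 0 `sorry`.  Imports BY NAME n15-c∕357 `…CovariantTwoGridLineProductDefect` (`mprod_sub_mprod_eq_sum`,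
`norm_mprod_sub_one_le_sum_of_unitary`, `frob_norm_mul_mul_conjTranspose_le`, `frob_norm_comb4_le`, `sandwich_twoGrid_identity`, `norm_eq_one_of_conjTranspose_mul_self`; through it this
seat's `mprod`, `conjTranspose_mprod_mul_self`, `norm_mul_unitary_eq`).  Nothing in the tree is modified, no landed name re-declared.

WHY (HOME memo `EVIDENCE-N15C-G33-DIVERGENCE-FIT.md` §4–§5 (H)).  n15-c∕357 `norm_lineProducts_defect_le` reads the third letter PER STEP (`‖T_{t+2} − 2T_{t+1} + T_t‖ ≤ γ`) and sums it
over the `2N`-window: each of the `N²` forward differences is within `2Nγ` of the one at the base point.  On the series' Hölder-`β` datum ([Balaban1985Variational] Thm 1 (9) with `β < 1` as the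
proofs of [Balaban1985RegularSpaces] Thm 2 deliver it; cell GAPS C-B8-18) the per-step letter is `γ = η′^{2+β}C_βξ^{−2−β}` and the window sum `2Nγ` is `2η·η′^{β−1}·(…)` — the factor
`(η∕η′)^{1−β} = L^{r(1−β)}` of n15-c∕360 v1.1 ∕ 364's docstring, NOT uniform in the fine spacing.  The Hölder clause itself is PAIRWISE: it bounds `‖∇A(z′) − ∇A(z)‖` by
`C_βξ^{−2−β}|z − z′|^β` directly, i.e. the difference of two forward differences `T_{t+1} − T_t`, `T_{t′+1} − T_{t′}` by `Γ = η′²·(C_βξ^{−2−β}(2η)^β + …)` with NO window sum.  THIS FILE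
re-runs 357's two theorems with the pairwise letter `Γ` in place of `γ`:
* §1 ★★★ `norm_lineProducts_defect_le_of_pairwise`: unitary `T_t` (`t < 2N`, `N ≥ 1`), `‖T_t − 1‖ ≤ α`, `‖T_{t+1} − T_t‖ ≤ β`, `‖(T_{t+1} − T_t) − (T_{t′+1} − T_{t′})‖ ≤ Γ` (`t+1, t′+1 < 2N`)
  ⟹ `‖Π_{t<N}T_{N+t} − Π_{t<N}T_t − N²·(T_N − T_{N−1})‖ ≤ 2N³αβ + N²Γ` (357's double telescoping verbatim; the `N²` forward differences are each within `Γ` of the base one).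
* §2 ★★★ `frob_twoGridAd_apply_le_of_pairwise`: with `n_f = N·n_c`, for every `X`,
  `‖n_f²(T_NXT_Nᴴ − T_{N−1}XT_{N−1}ᴴ) − n_c²(Π₊XΠ₊ᴴ − Π₋XΠ₋ᴴ)‖_F ≤ |n|·(2n_c²(2N³αβ + N²Γ) + 2n_f²(N+1)αβ)·‖X‖_F` — at `α = η′p`, `β = η′²q`, `Γ = η′²G`, `N = L^r`, `n_f = η′⁻¹`, `n_c = η⁻¹`
  the right side is `|n|·(4ηpq + 2G + 2(η + η′)pq)·‖X‖_F`: `O(G) + O(η)` with NO factor `N^{1−β}`.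
357's per-step statements follow from these with `Γ := 2Nγ` (357 `norm_sub_le_of_steps`); they are not restated.

HONEST FRAMING ∕ LIMITS.  Finite-dimensional linear algebra over DISPLAYED letters; nothing of [B9]∕[B11] asserted.  NE2⁺ NOT PRINTED ∕ NOT proved; N15 of record untouched; K3⁸ OPEN; counts
of record UNMOVED (typed 28∕28 · discharged 8∕27); one finite 𝕋⁴ at fixed ε per index — NOT infinite volume, NOT OS on ℝ⁴, NOT a mass gap, NOT Clay.  Restate-immune (no Theses import).
-/

set_option autoImplicit false

noncomputable section

open scoped BigOperators Matrix
open Finset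

namespace Summit.QuantumFields.YangMills.BalabanUVNodes.N15.CovAvg

/-! ## §1 Ordered products of unitary factors: the double telescoping with a PAIRWISE third letter -/

section LineProducts

open scoped Matrix.Norms.L2Operator

variable {mm : Type} [Fintype mm] [DecidableEq mm]

/-- ★★★ **THE LINE PRODUCTS AT TWO SPACINGS, PAIRWISE THIRD LETTER**: for unitary `T_t`, `t < 2N` (`N ≥ 1`), with `‖T_t − 1‖ ≤ α`, `‖T_{t+1} − T_t‖ ≤ β` and the PAIRWISE letter
`‖(T_{t+1} − T_t) − (T_{t′+1} − T_{t′})‖ ≤ Γ` for all `t+1, t′+1 < 2N` (operator norm):  `‖Π_{t<N}T_{N+t} − Π_{t<N}T_t − N²·(T_N − T_{N−1})‖ ≤ 2N³αβ + N²Γ` — the coarse backward difference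
of the two straight holonomies is `N²` times the fine backward difference at the base point up to `2N³αβ + N²Γ` (`= O(η + G)·η′⁻²` at `α = η′p`, `β = η′²q`, `Γ = η′²G`, `N = η∕η′`; on
Hölder-`β` data `G = O(η^β)` UNIFORMLY in `N`). [cite: Balaban1985Averaging, (124)–(126) p.36 (the straight holonomy and its slow variation: shape); Balaban1985BackgroundPropagators, (3.35)
p.396, (3.40) p.397, (3.52) p.400 (shape); Balaban1985Variational, Thm 1 (9) p.279 (the pairwise Hölder clause: shape)] -/
theorem norm_lineProducts_defect_le_of_pairwise (T : ℕ → Matrix mm mm ℂ) {N : ℕ} (hN : 1 ≤ N) (hT : ∀ t, t < 2 * N → (T t)ᴴ * T t = 1) {α β Γ : ℝ}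
    (hα0 : 0 ≤ α) (hβ0 : 0 ≤ β) (hα : ∀ t, t < 2 * N → ‖T t - 1‖ ≤ α) (hβ : ∀ t, t + 1 < 2 * N → ‖T (t + 1) - T t‖ ≤ β)
    (hΓ : ∀ t t', t + 1 < 2 * N → t' + 1 < 2 * N → ‖(T (t + 1) - T t) - (T (t' + 1) - T t')‖ ≤ Γ) :
    ‖mprod (fun t => T (N + t)) N - mprod T N - ((N : ℝ) ^ 2) • (T N - T (N - 1))‖ ≤ 2 * (N : ℝ) ^ 3 * (α * β) + (N : ℝ) ^ 2 * Γ := by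
  -- the products telescope
  have hP := mprod_sub_mprod_eq_sum (fun t => T (N + t)) T N
  -- the factor differences telescope: `T(N+s) − T s = Σ_{j<N} (T(s+j+1) − T(s+j))`
  have hX : ∀ s, T (N + s) - T s = ∑ j ∈ range N, (T (s + j + 1) - T (s + j)) := fun s => by
    have h := Finset.sum_range_sub (fun j => T (s + j)) N
    simp only [add_zero] at h
    rw [add_comm N s, ← h]
    exact Finset.sum_congr rfl fun j _ => rfl
  -- `N²·D` as a double sum
  have hD : ((N : ℝ) ^ 2) • (T N - T (N - 1)) = ∑ _s ∈ range N, ∑ _j ∈ range N, (T N - T (N - 1)) := by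
    rw [Finset.sum_const, Finset.sum_const, Finset.card_range, ← mul_nsmul', ← Nat.cast_smul_eq_nsmul ℝ, Nat.cast_mul, sq]
  -- splitting
  have hR1 : ∑ s ∈ range N, (mprod (fun t => T (N + t)) s * (T (N + s) - T s) * mprod (fun t => T (s + 1 + t)) (N - 1 - s) - (T (N + s) - T s)) =
      (mprod (fun t => T (N + t)) N - mprod T N) - ∑ s ∈ range N, (T (N + s) - T s) := by
    rw [hP, Finset.sum_sub_distrib]
  have hR2 : ∑ s ∈ range N, ∑ j ∈ range N, ((T (s + j + 1) - T (s + j)) - (T N - T (N - 1))) =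
      ∑ s ∈ range N, (T (N + s) - T s) - ((N : ℝ) ^ 2) • (T N - T (N - 1)) := by
    rw [hD, ← Finset.sum_sub_distrib]
    refine Finset.sum_congr rfl fun s _ => ?_
    rw [Finset.sum_sub_distrib, ← hX s]
  have hsplit : mprod (fun t => T (N + t)) N - mprod T N - ((N : ℝ) ^ 2) • (T N - T (N - 1)) =
      ∑ s ∈ range N, (mprod (fun t => T (N + t)) s * (T (N + s) - T s) * mprod (fun t => T (s + 1 + t)) (N - 1 - s) - (T (N + s) - T s)) +
        ∑ s ∈ range N, ∑ j ∈ range N, ((T (s + j + 1) - T (s + j)) - (T N - T (N - 1))) := by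
    rw [hR1, hR2]
    abel
  rw [hsplit]
  -- the unitary partial products
  have hL : ∀ s < N, ‖mprod (fun t => T (N + t)) s - 1‖ ≤ N * α := fun s hs => by
    refine (norm_mprod_sub_one_le_sum_of_unitary fun i hi => hT (N + i) (by omega)).trans ?_
    calc ∑ i ∈ range s, ‖T (N + i) - 1‖ ≤ ∑ _i ∈ range s, α := Finset.sum_le_sum fun i hi => hα (N + i) (by have := Finset.mem_range.mp hi; omega)
      _ = s * α := by rw [Finset.sum_const, Finset.card_range, nsmul_eq_mul]
      _ ≤ N * α := mul_le_mul_of_nonneg_right (by exact_mod_cast hs.le) hα0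
  have hR : ∀ s < N, ‖mprod (fun t => T (s + 1 + t)) (N - 1 - s) - 1‖ ≤ N * α := fun s hs => by
    refine (norm_mprod_sub_one_le_sum_of_unitary fun i hi => hT (s + 1 + i) (by omega)).trans ?_
    calc ∑ i ∈ range (N - 1 - s), ‖T (s + 1 + i) - 1‖ ≤ ∑ _i ∈ range (N - 1 - s), α :=
          Finset.sum_le_sum fun i hi => hα (s + 1 + i) (by have := Finset.mem_range.mp hi; omega)
      _ = ((N - 1 - s : ℕ) : ℝ) * α := by rw [Finset.sum_const, Finset.card_range, nsmul_eq_mul]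
      _ ≤ N * α := mul_le_mul_of_nonneg_right (by exact_mod_cast (by omega : N - 1 - s ≤ N)) hα0
  have hRu : ∀ s < N, (mprod (fun t => T (s + 1 + t)) (N - 1 - s))ᴴ * mprod (fun t => T (s + 1 + t)) (N - 1 - s) = 1 := fun s hs =>
    conjTranspose_mprod_mul_self fun i hi => hT (s + 1 + i) (by omega)
  have hXn : ∀ s < N, ‖T (N + s) - T s‖ ≤ N * β := fun s hs => by
    rw [hX s]
    refine (norm_sum_le _ _).trans ?_
    calc ∑ j ∈ range N, ‖T (s + j + 1) - T (s + j)‖ ≤ ∑ _j ∈ range N, β := Finset.sum_le_sum fun j hj => hβ (s + j) (by have := Finset.mem_range.mp hj; omega)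
      _ = N * β := by rw [Finset.sum_const, Finset.card_range, nsmul_eq_mul]
  -- first sum: `‖LXR − X‖ ≤ ‖L − 1‖‖X‖ + ‖X‖‖R − 1‖ ≤ 2N²αβ`
  have h1 : ∀ s ∈ range N, ‖mprod (fun t => T (N + t)) s * (T (N + s) - T s) * mprod (fun t => T (s + 1 + t)) (N - 1 - s) - (T (N + s) - T s)‖ ≤ 2 * ((N : ℝ) ^ 2 * (α * β)) := by
    intro s hs
    have hs' := Finset.mem_range.mp hs
    set Lm := mprod (fun t => T (N + t)) s
    set Rm := mprod (fun t => T (s + 1 + t)) (N - 1 - s)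
    set Xs := T (N + s) - T s
    have hid : Lm * Xs * Rm - Xs = (Lm - 1) * Xs * Rm + Xs * (Rm - 1) := by noncomm_ring
    rw [hid]
    calc ‖(Lm - 1) * Xs * Rm + Xs * (Rm - 1)‖ ≤ ‖(Lm - 1) * Xs * Rm‖ + ‖Xs * (Rm - 1)‖ := norm_add_le _ _
      _ ≤ ‖Lm - 1‖ * ‖Xs‖ + ‖Xs‖ * ‖Rm - 1‖ := by
          rw [norm_mul_unitary_eq (hRu s hs')]
          exact add_le_add (norm_mul_le _ _) (norm_mul_le _ _)
      _ ≤ (N * α) * (N * β) + (N * β) * (N * α) :=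
          add_le_add (mul_le_mul (hL s hs') (hXn s hs') (norm_nonneg _) (by positivity)) (mul_le_mul (hXn s hs') (hR s hs') (norm_nonneg _) (by positivity))
      _ = 2 * ((N : ℝ) ^ 2 * (α * β)) := by ring
  -- second sum: each forward difference is within `Γ` of the one at the base point (PAIRWISE letter, no window sum)
  have h2 : ∀ s ∈ range N, ∀ j ∈ range N, ‖(T (s + j + 1) - T (s + j)) - (T N - T (N - 1))‖ ≤ Γ := by
    intro s hs j hj
    have hs' := Finset.mem_range.mp hs
    have hj' := Finset.mem_range.mp hj
    have h := hΓ (s + j) (N - 1) (by omega) (by omega)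
    simp only [show N - 1 + 1 = N by omega] at h
    exact h
  calc _ ≤ ‖∑ s ∈ range N, (mprod (fun t => T (N + t)) s * (T (N + s) - T s) * mprod (fun t => T (s + 1 + t)) (N - 1 - s) - (T (N + s) - T s))‖ +
          ‖∑ s ∈ range N, ∑ j ∈ range N, ((T (s + j + 1) - T (s + j)) - (T N - T (N - 1)))‖ := norm_add_le _ _
    _ ≤ ∑ s ∈ range N, 2 * ((N : ℝ) ^ 2 * (α * β)) + ∑ s ∈ range N, ∑ _j ∈ range N, Γ := by
        refine add_le_add ((norm_sum_le _ _).trans (Finset.sum_le_sum h1)) ((norm_sum_le _ _).trans (Finset.sum_le_sum fun s hs => ?_))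
        exact (norm_sum_le _ _).trans (Finset.sum_le_sum fun j hj => h2 s hs j hj)
    _ = 2 * (N : ℝ) ^ 3 * (α * β) + (N : ℝ) ^ 2 * Γ := by simp only [Finset.sum_const, Finset.card_range, nsmul_eq_mul]; ring

end LineProducts

/-! ## §2 The adjoint actions at two spacings with the pairwise third letter, pointwise in the Frobenius norm -/

section Adjoint

open scoped Matrix.Norms.L2Operator

variable {mm : Type} [Fintype mm] [DecidableEq mm] [Nonempty mm]

/-- ★★★ **THE ADJOINT ACTIONS OF THE LINE PRODUCTS AT TWO SPACINGS, PAIRWISE THIRD LETTER, POINTWISE IN THE FROBENIUS NORM**: unitary `T_t` (`t < 2N`, `N ≥ 1`) with the letters `α, β`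
and the pairwise `Γ` of `norm_lineProducts_defect_le_of_pairwise`, `Π₋ = Π_{t<N}T_t`, `Π₊ = Π_{t<N}T_{N+t}`, any real `n_c`, `n_f = N·n_c`: for every matrix `X`,
`‖n_f²(T_NXT_Nᴴ − T_{N−1}XT_{N−1}ᴴ) − n_c²(Π₊XΠ₊ᴴ − Π₋XΠ₋ᴴ)‖_F ≤ |n|·(2n_c²(2N³αβ + N²Γ) + 2n_f²(N+1)αβ)·‖X‖_F` (left side in the Frobenius norm, written explicitly; letters in the operator
norm). [cite: Balaban1985Averaging, (124)–(126) p.36 (shape); Balaban1985BackgroundPropagators, (3.35) p.396, (3.50)–(3.52) p.400 (shape: `R(U) = Ad`); Balaban1985Variational, Thm 1 (9)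
p.279 (pairwise Hölder clause: shape)] -/
theorem frob_twoGridAd_apply_le_of_pairwise (T : ℕ → Matrix mm mm ℂ) {N : ℕ} (hN : 1 ≤ N) (hT : ∀ t, t < 2 * N → (T t)ᴴ * T t = 1) {α β Γ : ℝ}
    (hα0 : 0 ≤ α) (hβ0 : 0 ≤ β) (hΓ0 : 0 ≤ Γ) (hα : ∀ t, t < 2 * N → ‖T t - 1‖ ≤ α) (hβ : ∀ t, t + 1 < 2 * N → ‖T (t + 1) - T t‖ ≤ β)
    (hΓ : ∀ t t', t + 1 < 2 * N → t' + 1 < 2 * N → ‖(T (t + 1) - T t) - (T (t' + 1) - T t')‖ ≤ Γ) (nc : ℝ) (X : Matrix mm mm ℂ) :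
    @Norm.norm _ Matrix.frobeniusSeminormedAddCommGroup.toNorm
        (((N * nc) ^ 2) • (T N * X * (T N)ᴴ - T (N - 1) * X * (T (N - 1))ᴴ) -
          (nc ^ 2) • (mprod (fun t => T (N + t)) N * X * (mprod (fun t => T (N + t)) N)ᴴ - mprod T N * X * (mprod T N)ᴴ)) ≤
      Fintype.card mm * (2 * nc ^ 2 * (2 * (N : ℝ) ^ 3 * (α * β) + (N : ℝ) ^ 2 * Γ) + 2 * (N * nc) ^ 2 * ((N + 1) * α * β)) * @Norm.norm _ Matrix.frobeniusSeminormedAddCommGroup.toNorm X := by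
  set a := T N with ha
  set b := T (N - 1) with hb
  set c := mprod (fun t => T (N + t)) N with hc
  set dd := mprod T N with hdd
  have hE := norm_lineProducts_defect_le_of_pairwise T hN hT hα0 hβ0 hα hβ hΓ
  rw [← hc, ← hdd, ← ha, ← hb] at hE
  have hE0 : 0 ≤ 2 * (N : ℝ) ^ 3 * (α * β) + (N : ℝ) ^ 2 * Γ := by positivity
  have h2N : N < 2 * N := by omega
  -- letters of the four matrices
  have hab : ‖a - b‖ ≤ β := by
    have h := hβ (N - 1) (by omega); rwa [show N - 1 + 1 = N by omega] at h
  have hcu : cᴴ * c = 1 := conjTranspose_mprod_mul_self fun t ht => hT (N + t) (by omega)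
  have hdu : ddᴴ * dd = 1 := conjTranspose_mprod_mul_self fun t ht => hT t (by omega)
  have hc1 : ‖c - 1‖ ≤ N * α := by
    refine (norm_mprod_sub_one_le_sum_of_unitary fun i hi => hT (N + i) (by omega)).trans ?_
    calc ∑ i ∈ range N, ‖T (N + i) - 1‖ ≤ ∑ _i ∈ range N, α := Finset.sum_le_sum fun i hi => hα (N + i) (by have := Finset.mem_range.mp hi; omega)
      _ = N * α := by rw [Finset.sum_const, Finset.card_range, nsmul_eq_mul]
  have hd1 : ‖dd - 1‖ ≤ N * α := by
    refine (norm_mprod_sub_one_le_sum_of_unitary fun i hi => hT i (by omega)).trans ?_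
    calc ∑ i ∈ range N, ‖T i - 1‖ ≤ ∑ _i ∈ range N, α := Finset.sum_le_sum fun i hi => hα i (by have := Finset.mem_range.mp hi; omega)
      _ = N * α := by rw [Finset.sum_const, Finset.card_range, nsmul_eq_mul]
  have hac : ‖a - c‖ ≤ (N + 1) * α := by
    have e1 : a - c = (a - 1) - (c - 1) := by abel
    rw [e1]
    calc ‖(a - 1) - (c - 1)‖ ≤ ‖a - 1‖ + ‖c - 1‖ := norm_sub_le _ _
      _ ≤ α + N * α := add_le_add (hα N h2N) hc1
      _ = (N + 1) * α := by ring
  have hbd : ‖b - dd‖ ≤ (N + 1) * α := by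
    have e1 : b - dd = (b - 1) - (dd - 1) := by abel
    rw [e1]
    calc ‖(b - 1) - (dd - 1)‖ ≤ ‖b - 1‖ + ‖dd - 1‖ := norm_sub_le _ _
      _ ≤ α + N * α := add_le_add (hα (N - 1) (by omega)) hd1
      _ = (N + 1) * α := by ring
  have hcn : ‖c‖ = 1 := norm_eq_one_of_conjTranspose_mul_self hcu
  have hdn : ‖dd‖ = 1 := norm_eq_one_of_conjTranspose_mul_self hdu
  -- the identity and the four sandwich bounds
  have hid := sandwich_twoGrid_identity a b c dd X ((N : ℝ) ^ 2) (nc ^ 2)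
  have hnf : nc ^ 2 * (N : ℝ) ^ 2 = (N * nc) ^ 2 := by ring
  rw [hnf] at hid
  set E := c - dd - ((N : ℝ) ^ 2) • (a - b) with hEdef
  have hm0 : (0 : ℝ) ≤ Fintype.card mm := Nat.cast_nonneg _
  set XF := @Norm.norm _ Matrix.frobeniusSeminormedAddCommGroup.toNorm X with hXF
  have hXF0 : 0 ≤ XF := @norm_nonneg _ Matrix.frobeniusSeminormedAddCommGroup.toSeminormedAddGroup X
  have s1 := frob_norm_mul_mul_conjTranspose_le (a - b) X (a - c)
  have s2 := frob_norm_mul_mul_conjTranspose_le (b - dd) X (a - b)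
  have s3 := frob_norm_mul_mul_conjTranspose_le E X c
  have s4 := frob_norm_mul_mul_conjTranspose_le dd X E
  have t1 : @Norm.norm _ Matrix.frobeniusSeminormedAddCommGroup.toNorm ((a - b) * X * (a - c)ᴴ) ≤ Fintype.card mm * (β * ((N + 1) * α)) * XF :=
    s1.trans (mul_le_mul_of_nonneg_right (mul_le_mul_of_nonneg_left (mul_le_mul hab hac (norm_nonneg _) hβ0) hm0) hXF0)
  have t2 : @Norm.norm _ Matrix.frobeniusSeminormedAddCommGroup.toNorm ((b - dd) * X * (a - b)ᴴ) ≤ Fintype.card mm * (((N + 1) * α) * β) * XF :=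
    s2.trans (mul_le_mul_of_nonneg_right (mul_le_mul_of_nonneg_left (mul_le_mul hbd hab (norm_nonneg _) (by positivity)) hm0) hXF0)
  have t3 : @Norm.norm _ Matrix.frobeniusSeminormedAddCommGroup.toNorm (E * X * cᴴ) ≤ Fintype.card mm * ((2 * (N : ℝ) ^ 3 * (α * β) + (N : ℝ) ^ 2 * Γ) * 1) * XF :=
    s3.trans (mul_le_mul_of_nonneg_right (mul_le_mul_of_nonneg_left (mul_le_mul hE hcn.le (norm_nonneg _) hE0) hm0) hXF0)
  have t4 : @Norm.norm _ Matrix.frobeniusSeminormedAddCommGroup.toNorm (dd * X * Eᴴ) ≤ Fintype.card mm * (1 * (2 * (N : ℝ) ^ 3 * (α * β) + (N : ℝ) ^ 2 * Γ)) * XF :=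
    s4.trans (mul_le_mul_of_nonneg_right (mul_le_mul_of_nonneg_left (mul_le_mul hdn.le hE (norm_nonneg _) zero_le_one) hm0) hXF0)
  rw [hid]
  have hnc2 : 0 ≤ nc ^ 2 := sq_nonneg _
  have hnf2 : 0 ≤ ((N : ℝ) * nc) ^ 2 := sq_nonneg _
  calc _ ≤ ((N : ℝ) * nc) ^ 2 * @Norm.norm _ Matrix.frobeniusSeminormedAddCommGroup.toNorm ((a - b) * X * (a - c)ᴴ) +
        ((N : ℝ) * nc) ^ 2 * @Norm.norm _ Matrix.frobeniusSeminormedAddCommGroup.toNorm ((b - dd) * X * (a - b)ᴴ) +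
        nc ^ 2 * @Norm.norm _ Matrix.frobeniusSeminormedAddCommGroup.toNorm (E * X * cᴴ) + nc ^ 2 * @Norm.norm _ Matrix.frobeniusSeminormedAddCommGroup.toNorm (dd * X * Eᴴ) :=
        frob_norm_comb4_le hnf2 hnc2 _ _ _ _
    _ ≤ ((N : ℝ) * nc) ^ 2 * (Fintype.card mm * (β * ((N + 1) * α)) * XF) + ((N : ℝ) * nc) ^ 2 * (Fintype.card mm * (((N + 1) * α) * β) * XF) +
        nc ^ 2 * (Fintype.card mm * ((2 * (N : ℝ) ^ 3 * (α * β) + (N : ℝ) ^ 2 * Γ) * 1) * XF) + nc ^ 2 * (Fintype.card mm * (1 * (2 * (N : ℝ) ^ 3 * (α * β) + (N : ℝ) ^ 2 * Γ)) * XF) := by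
        gcongr
    _ = Fintype.card mm * (2 * nc ^ 2 * (2 * (N : ℝ) ^ 3 * (α * β) + (N : ℝ) ^ 2 * Γ) + 2 * (N * nc) ^ 2 * ((N + 1) * α * β)) * XF := by ring

end Adjoint

end Summit.QuantumFields.YangMills.BalabanUVNodes.N15.CovAvg

end
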